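import Mathlib
import Summits.MatrixMultiplication.MatrixMultiplication.Theorems.HiddenToeplitzCornersHiddenCornerLemmaRStein
import Summits.MatrixMultiplication.MatrixMultiplication.Theorems.HiddenToeplitzCornersHiddenCornerLemmaRRelVis

/-!
# Mixed law `(p,q) = (1,1)`, normal form I: entries, the top rows of `F`, the middle rows of `E`

Support file for crux item `stmt-MatrixMultiplication-10752`
(`Summit.MatrixMultiplication.MatrixMultiplication.Theses.HiddenToeplitzCorners.HiddenCornerLemmaR`),
line `frobenius-dual-short-syzygies`, stub `stub_mixedLaw`, sub-case `(p,q) = (1,1)`.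

Normal form of the `(1,1)` class: `∇M = e_γ ⊗ h + k ⊗ e_ω` (`e_γ i = [i = γ]`; after the
triangular-Toeplitz normalisation of the generators).  This file proves

* `hclR_nf_entry` — the entry formula `M n m = [γ ≤ n ≤ m+γ] h (m+γ-n) + [ω ≤ m ≤ n+ω] k (n+ω-m)`
  (Stein inversion of the two rank-one displacements);
* `hclR_nf_disp_sum` — displacement of an evaluated pencil of the class;
* `hclR_nf_F_top` — in a corner `T(X) E = F X` of the class with `2 ≤ r`, the targets vanish on
  rows `< γ` (the landed relative-visibility lemma `hclR_relvis_bound`);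
* `hclR_nf_E_mid` — if moreover some `T(X₀)` is nonsingular and `1 ≤ γ`, the frame `E` vanishes
  on rows `[ω, ω+γ)` (rows `< γ` of `T(X₀) E` are the truncated product of the unit `k(X₀)` with
  the `ω`-shifted frame columns).
-/

set_option linter.dupNamespace false

namespace Summit.MatrixMultiplication.MatrixMultiplication.Theorems

open Matrix BigOperators Finset

/-- Entries of `A * (u ⊗ v) * B`. -/
private theorem nf1_mul_vecMulVec_mul_apply {N : ℕ} (A B : Matrix (Fin N) (Fin N) ℂ)
    (u v : Fin N → ℂ) (n m : Fin N) :
    (A * Matrix.vecMulVec u v * B) n m = (A *ᵥ u) n * (v ᵥ* B) m := by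
  rw [Matrix.mul_vecMulVec, Matrix.vecMulVec_mul, Matrix.vecMulVec_apply]

/-- Entries of the Stein sum `∑_{k<N} Z^k (u ⊗ v) (Zᵀ)^k`. -/
theorem hclR_nf_stein_entry {N : ℕ} (u v : Fin N → ℂ) (n m : Fin N) :
    (∑ k ∈ Finset.range N, (Matrix.of fun i j : Fin N => if (i : ℕ) = (j : ℕ) + 1 then (1 : ℂ) else 0) ^ k *
        Matrix.vecMulVec u v *
        ((Matrix.of fun i j : Fin N => if (i : ℕ) = (j : ℕ) + 1 then (1 : ℂ) else 0)ᵀ) ^ k) n m =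
      ∑ k ∈ Finset.range N, (if h : k ≤ (n : ℕ) then u ⟨(n : ℕ) - k, by omega⟩ else 0) *
        (if h : k ≤ (m : ℕ) then v ⟨(m : ℕ) - k, by omega⟩ else 0) := by
  rw [Matrix.sum_apply]
  refine Finset.sum_congr rfl fun k _ => ?_
  rw [nf1_mul_vecMulVec_mul_apply, ← Matrix.transpose_pow, Matrix.vecMul_transpose,
    hclR_shift_pow_mulVec, hclR_shift_pow_mulVec]

/-- **Entry formula of the `(1,1)` normal form.**  If `∇M = e_γ ⊗ h + k ⊗ e_ω` then
`M n m = [γ ≤ n ≤ m + γ] · h (m + γ - n) + [ω ≤ m ≤ n + ω] · k (n + ω - m)`. -/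
theorem hclR_nf_entry {N : ℕ} (γ ω : ℕ) (M : Matrix (Fin N) (Fin N) ℂ) (h k : Fin N → ℂ)
    (hdisp : M - (Matrix.of fun i j : Fin N => if (i : ℕ) = (j : ℕ) + 1 then (1 : ℂ) else 0) * M *
        (Matrix.of fun i j : Fin N => if (i : ℕ) = (j : ℕ) + 1 then (1 : ℂ) else 0)ᵀ =
      Matrix.vecMulVec (fun i : Fin N => if (i : ℕ) = γ then (1 : ℂ) else 0) h +
        Matrix.vecMulVec k (fun j : Fin N => if (j : ℕ) = ω then (1 : ℂ) else 0))
    (n m : Fin N) :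
    M n m = (if hc : γ ≤ (n : ℕ) ∧ (n : ℕ) ≤ (m : ℕ) + γ then h ⟨(m : ℕ) + γ - n, by omega⟩ else 0) +
      (if hc : ω ≤ (m : ℕ) ∧ (m : ℕ) ≤ (n : ℕ) + ω then k ⟨(n : ℕ) + ω - m, by omega⟩ else 0) := by
  set Z : Matrix (Fin N) (Fin N) ℂ :=
    Matrix.of fun i j : Fin N => if (i : ℕ) = (j : ℕ) + 1 then (1 : ℂ) else 0 with hZ
  set eγ : Fin N → ℂ := fun i => if (i : ℕ) = γ then (1 : ℂ) else 0 with heγ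
  set eω : Fin N → ℂ := fun j => if (j : ℕ) = ω then (1 : ℂ) else 0 with heω
  set S₁ := ∑ l ∈ Finset.range N, Z ^ l * Matrix.vecMulVec eγ h * (Zᵀ) ^ l with hS₁
  set S₂ := ∑ l ∈ Finset.range N, Z ^ l * Matrix.vecMulVec k eω * (Zᵀ) ^ l with hS₂
  have h₁ : S₁ - Z * S₁ * Zᵀ = Matrix.vecMulVec eγ h := by rw [hS₁, hZ]; exact hclR_stein_sum eγ h
  have h₂ : S₂ - Z * S₂ * Zᵀ = Matrix.vecMulVec k eω := by rw [hS₂, hZ]; exact hclR_stein_sum k eω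
  have hM : M = S₁ + S₂ := by
    have hd : (M - (S₁ + S₂)) = Z * (M - (S₁ + S₂)) * Zᵀ := by
      have e : M - (S₁ + S₂) - Z * (M - (S₁ + S₂)) * Zᵀ =
          (M - Z * M * Zᵀ) - (S₁ - Z * S₁ * Zᵀ) - (S₂ - Z * S₂ * Zᵀ) := by
        simp only [Matrix.mul_sub, Matrix.sub_mul, Matrix.mul_add, Matrix.add_mul]; abel
      have : M - (S₁ + S₂) - Z * (M - (S₁ + S₂)) * Zᵀ = 0 := by rw [e, hdisp, h₁, h₂]; abel
      exact sub_eq_zero.mp this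
    exact sub_eq_zero.mp (hclR_eq_zero_of_stein _ (by rw [hZ] at hd; exact hd))
  rw [hM, Matrix.add_apply, hS₁, hS₂, hZ, hclR_nf_stein_entry, hclR_nf_stein_entry]
  have hn := n.is_lt; have hm := m.is_lt
  congr 1
  · -- `u = eγ`: only `k = n - γ` survives
    by_cases hc : γ ≤ (n : ℕ) ∧ (n : ℕ) ≤ (m : ℕ) + γ
    · rw [dif_pos hc, Finset.sum_eq_single ((n : ℕ) - γ)]
      · rw [dif_pos (by omega), dif_pos (by omega)]
        simp only [heγ]
        rw [if_pos (by omega), one_mul]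
        congr 1; ext; simp only; omega
      · intro l _ hl
        by_cases hln : l ≤ (n : ℕ)
        · rw [dif_pos hln]; simp only [heγ]; rw [if_neg (by omega), zero_mul]
        · rw [dif_neg hln, zero_mul]
      · intro hl; rw [Finset.mem_range] at hl; omega
    · rw [dif_neg hc]
      refine Finset.sum_eq_zero fun l hl => ?_
      rw [Finset.mem_range] at hl
      by_cases hln : l ≤ (n : ℕ)
      · rw [dif_pos hln]; simp only [heγ]
        by_cases hlγ : (n : ℕ) - l = γ
        · rw [if_pos (by omega), dif_neg (by omega), mul_zero]
        · rw [if_neg (by omega), zero_mul]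
      · rw [dif_neg hln, zero_mul]
  · -- `v = eω`: only `k = m - ω` survives
    by_cases hc : ω ≤ (m : ℕ) ∧ (m : ℕ) ≤ (n : ℕ) + ω
    · rw [dif_pos hc, Finset.sum_eq_single ((m : ℕ) - ω)]
      · rw [dif_pos (by omega), dif_pos (by omega)]
        simp only [heω]
        rw [if_pos (by omega), mul_one]
        congr 1; ext; simp only; omega
      · intro l _ hl
        by_cases hlm : l ≤ (m : ℕ)
        · rw [dif_pos hlm]; simp only [heω]; rw [if_neg (by omega), mul_zero]
        · rw [dif_neg hlm, mul_zero]
      · intro hl; rw [Finset.mem_range] at hl; omega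
    · rw [dif_neg hc]
      refine Finset.sum_eq_zero fun l hl => ?_
      rw [Finset.mem_range] at hl
      by_cases hlm : l ≤ (m : ℕ)
      · rw [dif_pos hlm]; simp only [heω]
        by_cases hlω : (m : ℕ) - l = ω
        · rw [if_pos (by omega), dif_neg (by omega), zero_mul]
        · rw [if_neg (by omega), mul_zero]
      · rw [dif_neg hlm, mul_zero]

/-- Displacement of an evaluated pencil of the class: `∇(∑ X a b • T a b) =
e_γ ⊗ (∑ X a b • h a b) + (∑ X a b • k a b) ⊗ e_ω`. -/
theorem hclR_nf_disp_sum {r N : ℕ} (T : Fin r → Fin r → Matrix (Fin N) (Fin N) ℂ)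
    (u w : Fin N → ℂ) (h k : Fin r → Fin r → Fin N → ℂ)
    (hdisp : ∀ a b, T a b - (Matrix.of fun i j : Fin N => if (i : ℕ) = (j : ℕ) + 1 then (1 : ℂ) else 0) *
        T a b * (Matrix.of fun i j : Fin N => if (i : ℕ) = (j : ℕ) + 1 then (1 : ℂ) else 0)ᵀ =
      Matrix.vecMulVec u (h a b) + Matrix.vecMulVec (k a b) w)
    (X : Matrix (Fin r) (Fin r) ℂ) :
    (∑ a, ∑ b, X a b • T a b) -
        (Matrix.of fun i j : Fin N => if (i : ℕ) = (j : ℕ) + 1 then (1 : ℂ) else 0) *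
          (∑ a, ∑ b, X a b • T a b) *
          (Matrix.of fun i j : Fin N => if (i : ℕ) = (j : ℕ) + 1 then (1 : ℂ) else 0)ᵀ =
      Matrix.vecMulVec u (∑ a, ∑ b, X a b • h a b) + Matrix.vecMulVec (∑ a, ∑ b, X a b • k a b) w := by
  set Z : Matrix (Fin N) (Fin N) ℂ :=
    Matrix.of fun i j : Fin N => if (i : ℕ) = (j : ℕ) + 1 then (1 : ℂ) else 0 with hZ
  have e1 : Z * (∑ a, ∑ b, X a b • T a b) * Zᵀ = ∑ a, ∑ b, X a b • (Z * T a b * Zᵀ) := by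
    simp only [Matrix.mul_sum, Matrix.sum_mul, Matrix.mul_smul, Matrix.smul_mul]
  have e2 : Matrix.vecMulVec u (∑ a, ∑ b, X a b • h a b) + Matrix.vecMulVec (∑ a, ∑ b, X a b • k a b) w =
      ∑ a, ∑ b, X a b • (Matrix.vecMulVec u (h a b) + Matrix.vecMulVec (k a b) w) := by
    ext i j
    simp only [Matrix.add_apply, Matrix.vecMulVec_apply, Matrix.sum_apply, Finset.sum_apply,
      Pi.smul_apply, Matrix.smul_apply, smul_eq_mul, Finset.mul_sum, Finset.sum_mul,
      ← Finset.sum_add_distrib]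
    refine Finset.sum_congr rfl fun a _ => Finset.sum_congr rfl fun b _ => ?_
    ring
  rw [e1, e2, ← Finset.sum_sub_distrib]
  refine Finset.sum_congr rfl fun a _ => ?_
  rw [← Finset.sum_sub_distrib]
  refine Finset.sum_congr rfl fun b _ => ?_
  rw [← smul_sub, hdisp a b]

/-- Corner per coefficient (column form): `T a b *ᵥ (col c of E) = [b = c] • (col a of F)`. -/
theorem hclR_nf_corner_col {r N : ℕ} (T : Fin r → Fin r → Matrix (Fin N) (Fin N) ℂ)
    (E F : Matrix (Fin N) (Fin r) ℂ)
    (hcorner : ∀ X : Matrix (Fin r) (Fin r) ℂ, (∑ a : Fin r, ∑ b : Fin r, X a b • T a b) * E = F * X)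
    (a b c : Fin r) :
    T a b *ᵥ (fun i => E i c) = if b = c then (fun i => F i a) else 0 := by
  -- adapted from `hclR_gconst_d_one` (column extraction of the corner identity)
  have h1 := hcorner (Matrix.single a b 1)
  have hsum : (∑ a' : Fin r, ∑ b' : Fin r, (Matrix.single a b (1 : ℂ)) a' b' • T a' b') = T a b := by
    rw [Finset.sum_eq_single a]
    · rw [Finset.sum_eq_single b]
      · simp
      · intro b' _ hb'; simp [hb'.symm]
      · simp
    · intro a' _ ha'
      apply Finset.sum_eq_zero; intro b' _
      simp [ha'.symm]
    · simp
  rw [hsum] at h1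
  ext i
  have h2 := congr_fun (congr_fun h1 i) c
  rw [Matrix.mul_apply] at h2
  simp only [Matrix.mulVec, dotProduct]
  rw [h2, Matrix.mul_apply]
  by_cases hbc : b = c
  · subst hbc
    rw [if_pos rfl, Finset.sum_eq_single a]
    · simp
    · intro j _ hj; simp [hj.symm]
    · simp
  · rw [if_neg hbc]
    simp only [Pi.zero_apply]
    apply Finset.sum_eq_zero; intro j _
    simp only [Matrix.single_apply, mul_ite, mul_one, mul_zero, ite_eq_right_iff, and_imp]
    intro _ hbc'; exact absurd hbc' hbc

/-- **Top rows of `F`.**  In the `(1,1)` normal form, a corner with `2 ≤ r` has all targets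
supported on rows `≥ γ` (by `hclR_relvis_bound` with the cut `c = γ`: the constant left generator
`e_γ` vanishes on rows `< γ`, and a visible target would force `r ≤ q = 1`). -/
theorem hclR_nf_F_top (r N γ ω : ℕ) (T : Fin r → Fin r → Matrix (Fin N) (Fin N) ℂ)
    (E F : Matrix (Fin N) (Fin r) ℂ) (h k : Fin r → Fin r → Fin N → ℂ) (hr : 2 ≤ r)
    (hcorner : ∀ X : Matrix (Fin r) (Fin r) ℂ, (∑ a : Fin r, ∑ b : Fin r, X a b • T a b) * E = F * X)
    (hdisp : ∀ a b, T a b - (Matrix.of fun i j : Fin N => if (i : ℕ) = (j : ℕ) + 1 then (1 : ℂ) else 0) *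
        T a b * (Matrix.of fun i j : Fin N => if (i : ℕ) = (j : ℕ) + 1 then (1 : ℂ) else 0)ᵀ =
      Matrix.vecMulVec (fun i : Fin N => if (i : ℕ) = γ then (1 : ℂ) else 0) (h a b) +
        Matrix.vecMulVec (k a b) (fun j : Fin N => if (j : ℕ) = ω then (1 : ℂ) else 0)) :
    ∀ (i : Fin N) (a : Fin r), (i : ℕ) < γ → F i a = 0 := by
  intro i a hi
  by_contra hne
  have hvec : ∀ u v : Fin N → ℂ, Matrix.vecMulVec u v =
      Matrix.replicateCol (Fin 1) u * (Matrix.replicateCol (Fin 1) v)ᵀ := by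
    intro u v; ext i j; simp [Matrix.vecMulVec_apply, Matrix.mul_apply]
  have hle := hclR_relvis_bound r N 1 1 γ T E F
    (Matrix.replicateCol (Fin 1) (fun i : Fin N => if (i : ℕ) = γ then (1 : ℂ) else 0))
    (Matrix.replicateCol (Fin 1) (fun j : Fin N => if (j : ℕ) = ω then (1 : ℂ) else 0))
    (fun a b => Matrix.replicateCol (Fin 1) (h a b)) (fun a b => Matrix.replicateCol (Fin 1) (k a b))
    (by intro i' hi' k'; simp only [Matrix.replicateCol_apply]; rw [if_neg (by omega)])
    ⟨a, i, hi, hne⟩ hcorner (by intro a' b'; rw [hdisp a' b', hvec, hvec])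
  omega

/-- **Middle rows of `E`.**  In the `(1,1)` normal form with `1 ≤ γ`, if the targets vanish on
rows `< γ` and some `T(X₀)` is nonsingular, then every frame column vanishes on rows `[ω, ω+γ)`:
rows `< γ` of `T(X₀) E` are the truncated products `k(X₀) · E[ω+·]` modulo `s^γ`, `k(X₀) 0 ≠ 0`
(else row `0` of `T(X₀)` vanishes), and a unit is cancelled by triangular induction. -/
theorem hclR_nf_E_mid :
    ∀ (r N γ ω : ℕ) (T : Fin r → Fin r → Matrix (Fin N) (Fin N) ℂ)
      (E F : Matrix (Fin N) (Fin r) ℂ) (h k : Fin r → Fin r → Fin N → ℂ), 1 ≤ γ →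
      (∀ X : Matrix (Fin r) (Fin r) ℂ, (∑ a : Fin r, ∑ b : Fin r, X a b • T a b) * E = F * X) →
      (∀ a b, T a b - (Matrix.of fun i j : Fin N => if (i : ℕ) = (j : ℕ) + 1 then (1 : ℂ) else 0) *
          T a b * (Matrix.of fun i j : Fin N => if (i : ℕ) = (j : ℕ) + 1 then (1 : ℂ) else 0)ᵀ =
        Matrix.vecMulVec (fun i : Fin N => if (i : ℕ) = γ then (1 : ℂ) else 0) (h a b) +
          Matrix.vecMulVec (k a b) (fun j : Fin N => if (j : ℕ) = ω then (1 : ℂ) else 0)) →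
      (∀ (i : Fin N) (a : Fin r), (i : ℕ) < γ → F i a = 0) →
      ∀ (X₀ : Matrix (Fin r) (Fin r) ℂ), (∑ a : Fin r, ∑ b : Fin r, X₀ a b • T a b).det ≠ 0 →
      ∀ (m : Fin N) (c : Fin r), ω ≤ (m : ℕ) → (m : ℕ) < ω + γ → E m c = 0 := by
  intro r N γ ω T E F h k hγ hcorner hdisp hFtop X₀ hX₀
  set M := ∑ a : Fin r, ∑ b : Fin r, X₀ a b • T a b with hMdef
  set κ : Fin N → ℂ := ∑ a : Fin r, ∑ b : Fin r, X₀ a b • k a b with hκ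
  set η : Fin N → ℂ := ∑ a : Fin r, ∑ b : Fin r, X₀ a b • h a b with hη
  have hMdisp := hclR_nf_disp_sum T _ _ h k hdisp X₀
  rw [← hMdef, ← hη, ← hκ] at hMdisp
  have hMent := hclR_nf_entry γ ω M η κ hMdisp
  rcases Nat.eq_zero_or_pos N with hN | hN
  · intro m; subst hN; exact Fin.elim0 m
  -- row-`n` entries of `M` for `n < γ`
  have hMrow : ∀ n m : Fin N, (n : ℕ) < γ →
      M n m = if hc : ω ≤ (m : ℕ) ∧ (m : ℕ) ≤ (n : ℕ) + ω then κ ⟨(n : ℕ) + ω - m, by omega⟩ else 0 := by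
    intro n m hn
    rw [hMent, dif_neg (by omega), zero_add]
  -- `κ 0 ≠ 0`, else row `0` of `M` vanishes
  have hκ0 : κ ⟨0, hN⟩ ≠ 0 := by
    intro h0
    have h0' : ∀ i : Fin N, (i : ℕ) = 0 → κ i = 0 := by
      intro i hi; rw [show i = ⟨0, hN⟩ from Fin.ext hi]; exact h0
    apply hX₀
    refine Matrix.det_eq_zero_of_row_eq_zero ⟨0, hN⟩ fun m => ?_
    rw [hMrow _ _ (by simp only; omega)]
    split_ifs with hc
    · exact h0' _ (by simp only; omega)
    · rfl
  -- rows `n < γ` of `M *ᵥ E c` vanish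
  have hrow : ∀ (c : Fin r) (n : Fin N), (n : ℕ) < γ → ∑ m : Fin N, M n m * E m c = 0 := by
    intro c n hn
    have hc := hcorner X₀
    rw [← hMdef] at hc
    have hc' := congr_fun (congr_fun hc n) c
    rw [Matrix.mul_apply, Matrix.mul_apply] at hc'
    rw [hc']
    exact Finset.sum_eq_zero fun a _ => by rw [hFtop n a hn, zero_mul]
  -- triangular induction on `j < γ`
  have key : ∀ j : ℕ, j < γ → ∀ hj : ω + j < N, ∀ c : Fin r, E ⟨ω + j, hj⟩ c = 0 := by
    intro j
    induction j using Nat.strong_induction_on with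
    | _ j ih =>
      intro hjγ hjN c
      have h0 := hrow c ⟨j, by omega⟩ hjγ
      rw [Finset.sum_eq_single ⟨ω + j, hjN⟩] at h0
      · rw [hMrow _ _ (by simp only; omega), dif_pos (by simp only; constructor <;> omega)] at h0
        rcases mul_eq_zero.mp h0 with h1 | h1
        · exact absurd h1 (by
            rw [show (⟨(⟨j, by omega⟩ : Fin N) + ω - ((⟨ω + j, hjN⟩ : Fin N) : ℕ), _⟩ : Fin N) = ⟨0, hN⟩
              from Fin.ext (by simp only; omega)]
            exact hκ0)
        · exact h1
      · intro m _ hm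
        rw [hMrow _ _ (by omega)]
        by_cases hc : ω ≤ (m : ℕ) ∧ (m : ℕ) ≤ j + ω
        · rw [dif_pos (by simpa using hc)]
          have hlt : (m : ℕ) - ω < j := by
            rcases Nat.lt_or_ge ((m : ℕ) - ω) j with h1 | h1
            · exact h1
            · exfalso; apply hm; ext; simp only; omega
          have e : m = ⟨ω + ((m : ℕ) - ω), by omega⟩ := Fin.ext (by simp only; omega)
          have h2 : E m c = 0 := by
            rw [e]; exact ih ((m : ℕ) - ω) hlt (by omega) (by omega) c
          rw [h2, mul_zero]
        · rw [dif_neg (by simpa using hc), zero_mul]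
      · simp
  intro m c hm1 hm2
  have e : m = ⟨ω + ((m : ℕ) - ω), by omega⟩ := Fin.ext (by simp only; omega)
  rw [e]
  exact key ((m : ℕ) - ω) (by omega) (by omega) c

end Summit.MatrixMultiplication.MatrixMultiplication.Theorems
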